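import Summits.ResolutionOfSingularities.KangarooAtlas.MizutaniProfileTransfer
import Literature.AlgebraicGeometry.Resolution.HasseSchmidtLinearSubstitution
import HarnessLib

/-!
# Mizutani's conjecture `m(e) = 2p^e − 1` — the polynomial tower model, VI: linear changes `(φ_A ⊗ φ_A)`

Cell topic `Summits/ResolutionOfSingularities/KangarooAtlas` (pub-rosobs); namespace
`Summit.ResolutionOfSingularities.KangarooAtlas.Mizutani`.  Continuation of
`MizutaniProfileTransfer` (MIZUTANI-PROOF-g59 §5 AUTOMORPHISMS: linear maps `a ↦ Aa`, acting on
`t` by `t ↦ At`; §1.4 (P3)).  In-house chain, AI-written; not a resolution theorem.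

For the FULL tower (`κ = ι`, pairing `id`) and a matrix `A : ι → ι → F`:

* `linChange A` — the ring endomorphism `a_i ↦ Σ_j A_{ij} a_j` (the tree's `lsubst`) on
  coefficients and `t_i ↦ Σ_j A_{ij} t_j` on the `t`-variables (`= φ_A ⊗ φ_A`, since
  `t_i = a_i ⊗ 1 − 1 ⊗ a_i`); `lcCoeff A M' M` — the structure constants `coeff_{t^M} (At)^{M'}`;
  `coeff_linChange` — `coeff_{t^M}(A·ξ) = Σ_{M'} φ_A(coeff_{t^{M'}} ξ) · c_{M',M}(A)`.
* `dtaylor_comp_linChange` — the diagonal Taylor morphism intertwines `linChange A` with the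
  substitution `(a, t, u) ↦ (Aa, At, Au)`; hence the CHAIN RULE `hsOp_linChange`:
  `(D^{(T)}⊗1)(A·ω) = Σ_{T'} c_{T',T}(A) · A·((D^{(T')}⊗1) ω)` (MIZUTANI-PROOF-g59 §1.4 (P3):
  `φ Diff^i φ⁻¹ = Diff^i`).
* `lcCoeff_eq_zero_of_degree_ne` (the constants are graded) and, in characteristic `p` with
  `q = p^k`, `lcCoeff_eq_zero_of_not_inBox`: `c_{T',T}(A) = 0` for `T` in the box and `T'`
  outside it — `(Σ_j A_{ij} t_j)^q = Σ_j A_{ij}^q t_j^q` (Frobenius), which is why the linear change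
  respects the truncation `t^q = 0` and why only box rows enter the chain rule.

The rank consequence `σ_n(A·ω) ≤ σ_n(ω)` is part VII.

References: [Mizutani1973HironakaGroupSchemes] (Remark 2.10); [Oda1983HironakaGroupSchemeII]
(§1 p. 1166); [EGAIV4] Thm. 16.11.2.
-/

open MvPolynomial Literature.AlgebraicGeometry.Resolution

namespace Summit.ResolutionOfSingularities.KangarooAtlas.Mizutani

section LinChange

variable {ι F : Type*} [CommRing F] [Fintype ι]

/-- The structure constants of a linear change on `t`-monomials:
`c_{M',M}(A) = coeff_{t^M} Π_i (Σ_j A_{ij} t_j)^{M'_i}`.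
[cite: Mizutani1973HironakaGroupSchemes, Remark 2.10 (in-house proof, §5 Thm D″: the expansion of (At)^M)] -/
noncomputable def lcCoeff (A : ι → ι → F) (M' M : ι →₀ ℕ) : F :=
  coeff M (M'.prod fun i k => lsubstFun F A i ^ k)

/-- **The linear change `φ_A ⊗ φ_A`** on the model ring of the full tower: `a_i ↦ Σ_j A_{ij} a_j` on
coefficients, `t_i ↦ Σ_j A_{ij} t_j`. [cite: Mizutani1973HironakaGroupSchemes, Remark 2.10 (in-house proof, §5 AUTOMORPHISMS)] -/
noncomputable def linChange (A : ι → ι → F) : Rel ι ι F →+* Rel ι ι F :=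
  eval₂Hom (C.comp (lsubst F A).toRingHom) fun i => MvPolynomial.map C (lsubstFun F A i)

/-- `φ_A ⊗ φ_A` on coefficients. [cite: Mizutani1973HironakaGroupSchemes, Remark 2.10 (in-house proof, §5)] -/
@[simp] theorem linChange_C (A : ι → ι → F) (κ₀ : MvPolynomial ι F) :
    linChange A (C κ₀) = C (lsubst F A κ₀) := by
  simp [linChange]

/-- `φ_A ⊗ φ_A` on `t_i`. [cite: Mizutani1973HironakaGroupSchemes, Remark 2.10 (in-house proof, §5)] -/
@[simp] theorem linChange_X (A : ι → ι → F) (i : ι) :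
    linChange A (X i : Rel ι ι F) = MvPolynomial.map C (lsubstFun F A i) := by
  simp [linChange]

/-- `φ_A ⊗ φ_A` on a monomial: `A·(κ t^{M'}) = φ_A(κ) · (At)^{M'}`.
[cite: Mizutani1973HironakaGroupSchemes, Remark 2.10 (in-house proof, §5)] -/
theorem linChange_monomial (A : ι → ι → F) (M' : ι →₀ ℕ) (κ₀ : MvPolynomial ι F) :
    linChange A (monomial M' κ₀) =
      C (lsubst F A κ₀) * MvPolynomial.map C (M'.prod fun i k => lsubstFun F A i ^ k) := by
  rw [linChange, eval₂Hom_monomial, map_finsuppProd]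
  simp only [RingHom.comp_apply, map_pow]
  rfl

/-- **Coefficients after a linear change**:
`coeff_{t^M}(A·ξ) = Σ_{M' ∈ supp ξ} φ_A(coeff_{t^{M'}} ξ) · c_{M',M}(A)`.
[cite: Mizutani1973HironakaGroupSchemes, Remark 2.10 (in-house proof, §5 Thm D″)] -/
theorem coeff_linChange (A : ι → ι → F) (ξ : Rel ι ι F) (M : ι →₀ ℕ) :
    coeff M (linChange A ξ) =
      ∑ M' ∈ ξ.support, lsubst F A (coeff M' ξ) * C (lcCoeff A M' M) := by
  conv_lhs => rw [ξ.as_sum, map_sum, coeff_sum]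
  refine Finset.sum_congr rfl fun M' _ => ?_
  rw [linChange_monomial, coeff_C_mul, coeff_map, lcCoeff]

/-- The Taylor-side companion of `φ_A ⊗ φ_A`: coefficients by `linChange A`, `u ↦ Au`.
[cite: Mizutani1973HironakaGroupSchemes, Remark 2.10 (in-house proof, §1.4 (P3))] -/
noncomputable def linChangeTaylor (A : ι → ι → F) :
    MvPolynomial ι (Rel ι ι F) →+* MvPolynomial ι (Rel ι ι F) :=
  eval₂Hom (C.comp (linChange A)) fun i => MvPolynomial.map (C.comp C) (lsubstFun F A i)

variable [DecidableEq ι]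

/-- **The diagonal Taylor morphism intertwines the linear change with `(a, t, u) ↦ (Aa, At, Au)`.**
[cite: Mizutani1973HironakaGroupSchemes, Remark 2.10 (in-house proof, §1.4 (P3): φ Diff^i φ⁻¹ = Diff^i)] -/
theorem dtaylor_comp_linChange (A : ι → ι → F) :
    (dtaylor (id : ι → ι)).comp (linChange A) = (linChangeTaylor A).comp (dtaylor (F := F) id) := by
  have huOf : ∀ j : ι, uOf (F := F) (κ := ι) id j = X j := fun j =>
    uOf_apply (F := F) id Function.injective_id j
  have hcoeff : (dtaylorCoeff (ι := ι) (id : ι → ι)).comp (lsubst F A).toRingHom =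
      (linChangeTaylor A).comp (dtaylorCoeff (F := F) id) := by
    refine MvPolynomial.ringHom_ext (fun c => ?_) (fun k => ?_)
    · simp [linChangeTaylor]
    · simp only [RingHom.comp_apply, AlgHom.toRingHom_eq_coe, RingHom.coe_coe, lsubst_X,
        map_sum, map_mul, dtaylorCoeff_C, dtaylorCoeff_X, huOf, linChangeTaylor, coe_eval₂Hom,
        eval₂_add, eval₂_C, eval₂_X, RingHom.comp_apply, linChange_C, lsubst_X, map_sum, map_mul,
        lsubstFun, map_X, map_C]
      rw [← Finset.sum_add_distrib]
      refine Finset.sum_congr rfl fun j _ => ?_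
      ring
  refine MvPolynomial.ringHom_ext (fun κ₀ => ?_) (fun i => ?_)
  · have h := RingHom.congr_fun hcoeff κ₀
    simp only [RingHom.comp_apply, AlgHom.toRingHom_eq_coe, RingHom.coe_coe] at h
    rw [RingHom.comp_apply, RingHom.comp_apply, linChange_C, dtaylor_C, dtaylor_C, h]
  · simp only [RingHom.comp_apply, linChange_X, dtaylor_X, lsubstFun, map_sum, map_mul, map_C,
      map_X, dtaylor_C, dtaylorCoeff_C, dtaylor_X, linChangeTaylor, coe_eval₂Hom, eval₂_add,
      eval₂_C, eval₂_X, RingHom.comp_apply, linChange_X]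
    rw [← Finset.sum_add_distrib]
    refine Finset.sum_congr rfl fun j _ => ?_
    ring

/-- **Chain rule for `(D^{(T)}⊗1)` under a linear change** (MIZUTANI-PROOF-g59 §1.4 (P3)):
`(D^{(T)}⊗1)(A·ω) = Σ_{T'} c_{T',T}(A) · A·((D^{(T')}⊗1) ω)`, the sum over the `u`-support of
`ω(a + u, t + u)`. [cite: Mizutani1973HironakaGroupSchemes, Remark 2.10 (in-house proof, §1.4 (P3))] -/
theorem hsOp_linChange (A : ι → ι → F) (T : ι →₀ ℕ) (ω : Rel ι ι F) :
    hsOp id T (linChange A ω) =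
      ∑ T' ∈ (dtaylor id ω).support, C (C (lcCoeff A T' T)) * linChange A (hsOp id T' ω) := by
  have h := RingHom.congr_fun (dtaylor_comp_linChange (F := F) A) ω
  simp only [RingHom.comp_apply] at h
  rw [hsOp_apply, h]
  conv_lhs => rw [(dtaylor id ω).as_sum, map_sum, coeff_sum]
  refine Finset.sum_congr rfl fun T' _ => ?_
  rw [linChangeTaylor, eval₂Hom_monomial]
  have hprod : (T'.prod fun i k => (MvPolynomial.map (C.comp C : F →+* Rel ι ι F)) (lsubstFun F A i) ^ k) =
      MvPolynomial.map (C.comp C : F →+* Rel ι ι F) (T'.prod fun i k => lsubstFun F A i ^ k) := by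
    rw [map_finsuppProd]
    simp only [map_pow]
  rw [hprod, RingHom.comp_apply, coeff_C_mul, coeff_map, hsOp_apply, mul_comm]
  rfl

/-! ### Grading and truncation of the structure constants -/

omit [DecidableEq ι] in
/-- The structure constants are graded: `c_{M',M}(A) ≠ 0 ⇒ |M| = |M'|`.
[cite: Mizutani1973HironakaGroupSchemes, Remark 2.10 (in-house proof, §5: redistribution preserves |·|)] -/
theorem degree_eq_of_lcCoeff_ne_zero (A : ι → ι → F) {M' M : ι →₀ ℕ} (h : lcCoeff A M' M ≠ 0) :
    M.degree = M'.degree := by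
  classical
  have hhom : (M'.prod fun i k => lsubstFun F A i ^ k).IsHomogeneous M'.degree := by
    rw [Finsupp.prod, Finsupp.degree_apply]
    refine IsHomogeneous.prod M'.support (fun i => lsubstFun F A i ^ M' i) (fun i => M' i)
      fun i _ => ?_
    simpa using (isHomogeneous_lsubstFun F A i).pow (M' i)
  by_contra hne
  exact h (hhom.coeff_eq_zero hne)

omit [DecidableEq ι] in
/-- **Frobenius truncation**: in characteristic `p` with `q = p^k`, `c_{T',T}(A) = 0` whenever `T`
lies in the box `[0,q−1]^ι` and `T'` does not — `(Σ_j A_{ij} t_j)^{q} = Σ_j A_{ij}^{q} t_j^{q}`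
only produces exponents outside the box (MIZUTANI-PROOF-g59 §5 Thm D″: "those outside Box vanish
(`t_j^q = 0`)"; §8: `(Aa)_i^q = Σ_j A_{ij}^q a_j^q`).
[cite: Mizutani1973HironakaGroupSchemes, Remark 2.10 (in-house proof, §5 Thm D″ / §8)] -/
theorem lcCoeff_eq_zero_of_not_inBox (p : ℕ) [Fact p.Prime] [CharP F p] (k : ℕ) (A : ι → ι → F)
    {T' T : ι →₀ ℕ} (hT : InBox (p ^ k) T) (hT' : ¬ InBox (p ^ k) T') : lcCoeff A T' T = 0 := by
  classical
  obtain ⟨i₀, hi₀⟩ : ∃ i, p ^ k ≤ T' i := by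
    by_contra h
    push Not at h
    exact hT' h
  have hmem : i₀ ∈ T'.support := Finsupp.mem_support_iff.mpr (by
    have := Nat.one_le_pow k p (Nat.Prime.pos Fact.out); omega)
  rw [lcCoeff, Finsupp.prod, ← Finset.mul_prod_erase _ _ hmem]
  -- split off `(Σ_j A_{i₀ j} t_j)^q`
  obtain ⟨r, hr⟩ : ∃ r, T' i₀ = p ^ k + r := ⟨T' i₀ - p ^ k, by omega⟩
  rw [hr, pow_add, lsubstFun, sum_pow_char_pow, mul_assoc, Finset.sum_mul, coeff_sum]
  refine Finset.sum_eq_zero fun j _ => ?_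
  rw [mul_pow, ← map_pow, X_pow_eq_monomial, mul_assoc, coeff_C_mul, coeff_monomial_mul']
  rw [if_neg, mul_zero]
  intro hle
  have := hle j
  rw [Finsupp.single_eq_same] at this
  exact absurd (hT j) (not_lt.mpr this)

end LinChange

end Summit.ResolutionOfSingularities.KangarooAtlas.Mizutani
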